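import Mathlib.Data.ZMod.Basic
import Mathlib.Analysis.SpecialFunctions.Pow.Real
import Mathlib.Logic.Function.Iterate
import HarnessLib

/-!
# Cell qa-qnc0 (rung F-Q2-odd, `p = 3`): transfer operators of the fixed-bell ring game (ROUND-15 §9.7 (ii))

Planner qa-qnc0-p1 g17, route DWalkThree, support `RingFixedBellsSharp3` (stmt-QuantumAdvantage-22487), dense half,
linear-algebra layer.  States `d ∈ ℤ/3`, vectors `w : ℤ/3 → ℝ`; the normalised step operator
`(P w)(d) = (w(d+1) + w(d+2))/2`, the bell factor `(F w)(d) = f(d)·w(d)` with `f(0) = 1`, `f(1) = f(2) = -1`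
(a bell at state `d` is LIVE iff `d ≠ 0`), the cut operators `A_g = F^{[bell g]} ∘ P` and their compositions
`seg bell a l = A_a ∘ ⋯ ∘ A_{a+l-1}`.

* `nsq_Pop_le`, `nsq_Fop`, `nsq_seg_le` — every operator is an `ℓ²`-contraction;
* `Pop_iter` — closed form `P^g w = α_g w + β_g (Σw)𝟙`, `α_g = (-1/2)^g`, `β_g = (1-α_g)/3`;
* **`nsq_pair_le`** — the PAIR CONTRACTION `‖F P^g F P^h w‖² ≤ (5/8)‖w‖²` for `g, h ≥ 1`
  (Cauchy–Schwarz per row; `‖F P^g F P^h‖_F² = (1 + 8α_g² + 8α_h² + 10α_g²α_h²)/9 ≤ 5/8`);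
* `seg_add`, `seg_free`, `seg_block`, `seg_pair` — segment calculus.

WHAT THIS IS NOT: the path-sum identity and the count are `TransferWalk.lean`; separation NOT moved.
-/

noncomputable section

namespace Summit.QuantumAdvantage.AdviceFreeQNC0

namespace TransferWalk

open Finset

/-! ### Operators -/

/-- The bell factor at state `d`: `+1` if the bell is dead (`d = 0`), `-1` if it is live. -/
def fz (d : ZMod 3) : ℝ := if d = 0 then 1 else -1

/-- The normalised step operator `(P w)(d) = (w(d+1) + w(d+2))/2`. -/
def Pop (w : ZMod 3 → ℝ) : ZMod 3 → ℝ := fun d => (w (d + 1) + w (d + 2)) / 2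

/-- The bell operator `(F w)(d) = f(d)·w(d)`. -/
def Fop (w : ZMod 3 → ℝ) : ZMod 3 → ℝ := fun d => fz d * w d

/-- The cut operator: step, then the bell factor if cut `g` carries a bell. -/
def Aop (bell : ℕ → Bool) (g : ℕ) (w : ZMod 3 → ℝ) : ZMod 3 → ℝ :=
  if bell g then Fop (Pop w) else Pop w

/-- The segment operator `A_a ∘ A_{a+1} ∘ ⋯ ∘ A_{a+l-1}`. -/
def seg (bell : ℕ → Bool) : ℕ → ℕ → (ZMod 3 → ℝ) → (ZMod 3 → ℝ)
  | _, 0, w => w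
  | a, l + 1, w => Aop bell a (seg bell (a + 1) l w)

/-- Squared `ℓ²` norm. -/
def nsq (w : ZMod 3 → ℝ) : ℝ := w 0 ^ 2 + w 1 ^ 2 + w 2 ^ 2

/-- Coordinate sum. -/
def Ssum (w : ZMod 3 → ℝ) : ℝ := w 0 + w 1 + w 2

/-- `α_g = (-1/2)^g`. -/
def alpha (g : ℕ) : ℝ := (-1 / 2 : ℝ) ^ g

/-- The pair operator `F P^g F P^h`. -/
def pairOp (g h : ℕ) (w : ZMod 3 → ℝ) : ZMod 3 → ℝ := Fop (Pop^[g] (Fop (Pop^[h] w)))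

/-! ### Small facts in `ℤ/3` -/

/-- `0 + 1 = 1` in `ℤ/3`. -/
theorem z01 : (0 : ZMod 3) + 1 = 1 := by decide
/-- `0 + 2 = 2` in `ℤ/3`. -/
theorem z02 : (0 : ZMod 3) + 2 = 2 := by decide
/-- `1 + 1 = 2` in `ℤ/3`. -/
theorem z11 : (1 : ZMod 3) + 1 = 2 := by decide
/-- `1 + 2 = 0` in `ℤ/3`. -/
theorem z12 : (1 : ZMod 3) + 2 = 0 := by decide
/-- `2 + 1 = 0` in `ℤ/3`. -/
theorem z21 : (2 : ZMod 3) + 1 = 0 := by decide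
/-- `2 + 2 = 1` in `ℤ/3`. -/
theorem z22 : (2 : ZMod 3) + 2 = 1 := by decide
/-- `f(0) = 1`. -/
theorem fz_zero : fz 0 = 1 := if_pos rfl
/-- `f(1) = -1`. -/
theorem fz_one : fz 1 = -1 := if_neg (by decide)
/-- `f(2) = -1`. -/
theorem fz_two : fz 2 = -1 := if_neg (by decide)
/-- `f(d)² = 1`. -/
theorem fz_sq (d : ZMod 3) : fz d * fz d = 1 := by unfold fz; split_ifs <;> norm_num
/-- `f(d)² ≤ 1`. -/
theorem fz_sq_le (d : ZMod 3) : fz d ^ 2 ≤ 1 := by rw [sq, fz_sq]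

/-- The three coordinates of `P w`. -/
theorem Pop_apply (w : ZMod 3 → ℝ) :
    Pop w 0 = (w 1 + w 2) / 2 ∧ Pop w 1 = (w 2 + w 0) / 2 ∧ Pop w 2 = (w 0 + w 1) / 2 := by
  refine ⟨?_, ?_, ?_⟩
  · show (w (0 + 1) + w (0 + 2)) / 2 = _; rw [z01, z02]
  · show (w (1 + 1) + w (1 + 2)) / 2 = _; rw [z11, z12]
  · show (w (2 + 1) + w (2 + 2)) / 2 = _; rw [z21, z22]

/-- The three coordinates of `F w`. -/
theorem Fop_apply (w : ZMod 3 → ℝ) : Fop w 0 = w 0 ∧ Fop w 1 = -w 1 ∧ Fop w 2 = -w 2 := by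
  refine ⟨?_, ?_, ?_⟩
  · show fz 0 * w 0 = _; rw [fz_zero, one_mul]
  · show fz 1 * w 1 = _; rw [fz_one]; ring
  · show fz 2 * w 2 = _; rw [fz_two]; ring

/-! ### Contractions -/

/-- `nsq ≥ 0`. -/
theorem nsq_nonneg (w : ZMod 3 → ℝ) : 0 ≤ nsq w := by unfold nsq; positivity

/-- A coordinate is bounded by the norm: `w(E)² ≤ ‖w‖²`. -/
theorem sq_le_nsq (w : ZMod 3 → ℝ) (E : ZMod 3) : w E ^ 2 ≤ nsq w := by
  have h := Finset.single_le_sum (f := fun d : ZMod 3 => w d ^ 2) (fun d _ => sq_nonneg (w d)) (mem_univ E)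
  have h3 : ∑ d : ZMod 3, w d ^ 2 = w 0 ^ 2 + w 1 ^ 2 + w 2 ^ 2 := Fin.sum_univ_three _
  rw [h3] at h
  exact h

/-- `P` is a contraction. -/
theorem nsq_Pop_le (w : ZMod 3 → ℝ) : nsq (Pop w) ≤ nsq w := by
  obtain ⟨h0, h1, h2⟩ := Pop_apply w
  unfold nsq
  rw [h0, h1, h2]
  nlinarith [sq_nonneg (w 0 - w 1), sq_nonneg (w 1 - w 2), sq_nonneg (w 0 - w 2)]

/-- `F` is an isometry. -/
theorem nsq_Fop (w : ZMod 3 → ℝ) : nsq (Fop w) = nsq w := by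
  obtain ⟨h0, h1, h2⟩ := Fop_apply w
  unfold nsq
  rw [h0, h1, h2]; ring

/-- Every cut operator is a contraction. -/
theorem nsq_Aop_le (bell : ℕ → Bool) (g : ℕ) (w : ZMod 3 → ℝ) : nsq (Aop bell g w) ≤ nsq w := by
  unfold Aop
  split_ifs
  · rw [nsq_Fop]; exact nsq_Pop_le w
  · exact nsq_Pop_le w

/-- Every segment operator is a contraction. -/
theorem nsq_seg_le (bell : ℕ → Bool) : ∀ (l a : ℕ) (w : ZMod 3 → ℝ), nsq (seg bell a l w) ≤ nsq w
  | 0, _, _ => le_rfl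
  | l + 1, a, w => le_trans (nsq_Aop_le bell a _) (nsq_seg_le bell l (a + 1) w)

/-! ### Closed form of `P^g` and the pair contraction -/

/-- `P^g w = α_g·w + ((1 - α_g)/3)·(Σ w)·𝟙`. -/
theorem Pop_iter : ∀ (g : ℕ) (w : ZMod 3 → ℝ),
    Pop^[g] w = fun d => alpha g * w d + (1 - alpha g) / 3 * Ssum w
  | 0, w => by funext d; simp [alpha]
  | g + 1, w => by
    rw [Function.iterate_succ_apply', Pop_iter g w]
    have ha : alpha (g + 1) = alpha g * (-1 / 2) := by unfold alpha; rw [pow_succ]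
    obtain ⟨h0, h1, h2⟩ := Pop_apply (fun d => alpha g * w d + (1 - alpha g) / 3 * Ssum w)
    funext d
    have hd : d = 0 ∨ d = 1 ∨ d = 2 := by
      fin_cases d
      · exact Or.inl rfl
      · exact Or.inr (Or.inl rfl)
      · exact Or.inr (Or.inr rfl)
    unfold Ssum at *
    rcases hd with rfl | rfl | rfl
    · rw [h0, ha]; ring
    · rw [h1, ha]; ring
    · rw [h2, ha]; ring

/-- `α_g² ≤ 1/4` for `g ≥ 1`. -/
theorem alpha_sq_le {g : ℕ} (hg : 1 ≤ g) : alpha g ^ 2 ≤ 1 / 4 := by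
  have h : alpha g ^ 2 = (1 / 4 : ℝ) ^ g := by
    unfold alpha
    rw [← pow_mul, mul_comm, pow_mul]
    congr 1
    norm_num
  rw [h]
  calc (1 / 4 : ℝ) ^ g ≤ (1 / 4 : ℝ) ^ 1 := pow_le_pow_of_le_one (by norm_num) (by norm_num) hg
    _ = 1 / 4 := pow_one _

/-- The first bell layer of the pair operator as a pointwise product. -/
theorem Fop_eq (v : ZMod 3 → ℝ) : Fop v = fun d => fz d * v d := rfl

/-- `Σ_e f(e)·v(e) = v 0 - v 1 - v 2`. -/
theorem Ssum_Fop (v : ZMod 3 → ℝ) : Ssum (fun d => fz d * v d) = v 0 - v 1 - v 2 := by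
  simp only [Ssum, fz_zero, fz_one, fz_two]; ring

/-- Coordinates of the pair operator: with `a = α_g`, `b = α_h`, `S = Σw`, `y_e = b w_e + (1-b)/3·S`,
`(F P^g F P^h w)(d) = f(d)·(a·f(d)·y_d + (1-a)/3·(y_0 - y_1 - y_2))`. -/
theorem pairOp_apply (g h : ℕ) (w : ZMod 3 → ℝ) (d : ZMod 3) :
    pairOp g h w d = fz d * (alpha g * (fz d * (alpha h * w d + (1 - alpha h) / 3 * Ssum w)) +
      (1 - alpha g) / 3 * ((alpha h * w 0 + (1 - alpha h) / 3 * Ssum w) -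
        (alpha h * w 1 + (1 - alpha h) / 3 * Ssum w) - (alpha h * w 2 + (1 - alpha h) / 3 * Ssum w))) := by
  unfold pairOp
  simp only [Fop_eq]
  rw [Pop_iter h w, Pop_iter g, Ssum_Fop]

/-- **Pair contraction**: `‖F P^g F P^h w‖² ≤ (5/8)·‖w‖²` for `g, h ≥ 1`. -/
theorem nsq_pair_le {g h : ℕ} (hg : 1 ≤ g) (hh : 1 ≤ h) (w : ZMod 3 → ℝ) :
    nsq (pairOp g h w) ≤ 5 / 8 * nsq w := by
  -- three-term Cauchy–Schwarz (the tree's `Kerr.sq_dot_le_three`, restated locally to keep the imports light)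
  have cs3 : ∀ c0 c1 c2 x0 x1 x2 : ℝ,
      (c0 * x0 + c1 * x1 + c2 * x2) ^ 2 ≤ (c0 ^ 2 + c1 ^ 2 + c2 ^ 2) * (x0 ^ 2 + x1 ^ 2 + x2 ^ 2) :=
    fun c0 c1 c2 x0 x1 x2 => by
      nlinarith [sq_nonneg (c0 * x1 - c1 * x0), sq_nonneg (c0 * x2 - c2 * x0), sq_nonneg (c1 * x2 - c2 * x1)]
  have ha := alpha_sq_le hg
  have hb := alpha_sq_le hh
  -- the Frobenius bound `(1 + 8a² + 8b² + 10a²b²)/9 ≤ 5/8`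
  have hF : (1 + 8 * alpha g ^ 2 + 8 * alpha h ^ 2 + 10 * alpha g ^ 2 * alpha h ^ 2) / 9 ≤ 5 / 8 := by
    have hab : alpha g ^ 2 * alpha h ^ 2 ≤ 1 / 16 := by
      nlinarith [sq_nonneg (alpha g), sq_nonneg (alpha h)]
    linarith
  have e0 := pairOp_apply g h w 0
  have e1 := pairOp_apply g h w 1
  have e2 := pairOp_apply g h w 2
  rw [fz_zero] at e0
  rw [fz_one] at e1
  rw [fz_two] at e2
  unfold Ssum at e0 e1 e2
  obtain ⟨a, hadef⟩ : ∃ a, a = alpha g := ⟨_, rfl⟩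
  obtain ⟨b, hbdef⟩ : ∃ b, b = alpha h := ⟨_, rfl⟩
  rw [← hadef, ← hbdef] at e0 e1 e2 hF
  -- the five distinct matrix entries
  obtain ⟨k1, hk1⟩ : ∃ k : ℝ, k = a * b + a * ((1 - b) / 3) + (1 - a) / 3 * (b - (1 - b) / 3) := ⟨_, rfl⟩
  obtain ⟨k2, hk2⟩ : ∃ k : ℝ, k = a * ((1 - b) / 3) + (1 - a) / 3 * (-b - (1 - b) / 3) := ⟨_, rfl⟩
  obtain ⟨k3, hk3⟩ : ∃ k : ℝ, k = a * ((1 - b) / 3) - (1 - a) / 3 * (b - (1 - b) / 3) := ⟨_, rfl⟩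
  obtain ⟨k4, hk4⟩ : ∃ k : ℝ, k = a * b + a * ((1 - b) / 3) + (1 - a) / 3 * (b + (1 - b) / 3) := ⟨_, rfl⟩
  obtain ⟨k5, hk5⟩ : ∃ k : ℝ, k = a * ((1 - b) / 3) + (1 - a) / 3 * (b + (1 - b) / 3) := ⟨_, rfl⟩
  have r0 : pairOp g h w 0 = k1 * w 0 + k2 * w 1 + k2 * w 2 := by rw [e0, hk1, hk2]; ring
  have r1 : pairOp g h w 1 = k3 * w 0 + k4 * w 1 + k5 * w 2 := by rw [e1, hk3, hk4, hk5]; ring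
  have r2 : pairOp g h w 2 = k3 * w 0 + k5 * w 1 + k4 * w 2 := by rw [e2, hk3, hk4, hk5]; ring
  have hfrob : (k1 ^ 2 + k2 ^ 2 + k2 ^ 2) + (k3 ^ 2 + k4 ^ 2 + k5 ^ 2) + (k3 ^ 2 + k5 ^ 2 + k4 ^ 2) =
      (1 + 8 * a ^ 2 + 8 * b ^ 2 + 10 * a ^ 2 * b ^ 2) / 9 := by
    rw [hk1, hk2, hk3, hk4, hk5]; ring
  -- Cauchy–Schwarz per coordinate
  have c0 := cs3 k1 k2 k2 (w 0) (w 1) (w 2)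
  have c1 := cs3 k3 k4 k5 (w 0) (w 1) (w 2)
  have c2 := cs3 k3 k5 k4 (w 0) (w 1) (w 2)
  rw [← r0] at c0
  rw [← r1] at c1
  rw [← r2] at c2
  have hn : 0 ≤ nsq w := nsq_nonneg w
  have hsum : (k1 ^ 2 + k2 ^ 2 + k2 ^ 2) + (k3 ^ 2 + k4 ^ 2 + k5 ^ 2) + (k3 ^ 2 + k5 ^ 2 + k4 ^ 2) ≤ 5 / 8 := by
    rw [hfrob]; exact hF
  have key := mul_le_mul_of_nonneg_right hsum hn
  clear e0 e1 e2 r0 r1 r2 hfrob hF hsum hk1 hk2 hk3 hk4 hk5 hadef hbdef ha hb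
  unfold nsq at *
  linarith [c0, c1, c2, key]

/-! ### Segment calculus -/

/-- The value of a cut operator. -/
theorem Aop_apply (bell : ℕ → Bool) (g : ℕ) (w : ZMod 3 → ℝ) (d : ZMod 3) :
    Aop bell g w d = (if bell g then fz d else 1) * Pop w d := by
  unfold Aop Fop
  cases bell g <;> simp

/-- Segments compose. -/
theorem seg_add (bell : ℕ → Bool) : ∀ (l a l' : ℕ) (w : ZMod 3 → ℝ),
    seg bell a (l + l') w = seg bell a l (seg bell (a + l) l' w)
  | 0, a, l', w => by simp [seg]
  | l + 1, a, l', w => by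
    rw [show l + 1 + l' = (l + l') + 1 by omega]
    show Aop bell a (seg bell (a + 1) (l + l') w) = Aop bell a (seg bell (a + 1) l (seg bell (a + (l + 1)) l' w))
    rw [seg_add bell l (a + 1) l' w, show a + 1 + l = a + (l + 1) by omega]

/-- A bell-free segment is `P^l`. -/
theorem seg_free (bell : ℕ → Bool) : ∀ (l a : ℕ) (w : ZMod 3 → ℝ),
    (∀ g, a ≤ g → g < a + l → bell g = false) → seg bell a l w = Pop^[l] w
  | 0, _, _, _ => rfl
  | l + 1, a, w, h => by
    show Aop bell a (seg bell (a + 1) l w) = _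
    rw [seg_free bell l (a + 1) w fun g h1 h2 => h g (by omega) (by omega), Function.iterate_succ_apply']
    unfold Aop; rw [h a le_rfl (by omega)]; rfl

/-- A segment whose only bell is its first cut is `F P^l`. -/
theorem seg_block (bell : ℕ → Bool) {l a : ℕ} (w : ZMod 3 → ℝ) (hl : 1 ≤ l) (ha : bell a = true)
    (h : ∀ g, a < g → g < a + l → bell g = false) : seg bell a l w = Fop (Pop^[l] w) := by
  obtain ⟨l', rfl⟩ : ∃ l', l = l' + 1 := ⟨l - 1, by omega⟩
  show Aop bell a (seg bell (a + 1) l' w) = _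
  rw [seg_free bell l' (a + 1) w fun g h1 h2 => h g (by omega) (by omega), Function.iterate_succ_apply']
  unfold Aop; rw [ha]; rfl

/-- **Two consecutive bells**: if the bells of `[a, c)` are exactly `a < m`, the segment is the pair operator
`F P^{m-a} F P^{c-m}`. -/
theorem seg_pair (bell : ℕ → Bool) {a m c : ℕ} (ham : a < m) (hmc : m < c) (ha : bell a = true)
    (hm : bell m = true) (h : ∀ g, a < g → g < c → g ≠ m → bell g = false) (w : ZMod 3 → ℝ) :
    seg bell a (c - a) w = pairOp (m - a) (c - m) w := by
  rw [show c - a = (m - a) + (c - m) by omega, seg_add, show a + (m - a) = m by omega]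
  rw [seg_block bell w (by omega) hm fun g h1 h2 => h g (by omega) (by omega) (by omega)]
  rw [seg_block bell _ (by omega) ha fun g h1 h2 => h g h1 (by omega) (by omega)]
  rfl

end TransferWalk

end Summit.QuantumAdvantage.AdviceFreeQNC0

end
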